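import Summits.Ventures.YMGap.RobustBall.LangevinPoincareBall
import Summits.Ventures.YMGap.RobustBall.LangevinPoincareLimit
import Summits.Ventures.YMGap.RobustBall.PerturbedLimitStates
import HarnessLib

/-!
# Robust ball (Y2) — the Langevin Poincaré inequality for EVERY INFINITE-VOLUME LIMIT STATE OF EVERY MEMBER FAMILY of the torus ball, gradient form

HONEST FRAMING: venture file of the cell `pub-ymgap` (QuantumFields programme), track ROBUST-BALL, seat rb-p2 (g13); the BALL-UNIFORM infinite-volume
companion of `LangevinPoincareLimit.lean` (Wilson) on top of `LangevinPoincareBall.lean` (members, every torus).  LATTICE statements at STRONG COUPLING for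
the cell's perturbed limit states `perturbedLimitPoints β 𝓦` (rb-p2 g2: tight limits along tori of the member states of a family `𝓦 L : Perturbation d (L+1) N`);
existence of such limits is the cell's `perturbedLimitPoints_nonempty`; nothing about `β → ∞`, the continuum or Clay.
* ★★★ `variance_le_integral_Gam_of_mem_perturbedLimitPoints_of_torus` — from a torus inequality `Var_{μ_{β,𝓦 L}}(g) ≤ C ∫ Γ(g,g) dμ_{β,𝓦 L}` holding for
  every member of the family (sides `≥ 2`) and every smooth `g`, to `Var_μ(F) ≤ C ∫ Γ(f,f)((U_e)_{e∈Λ}) dμ(U)` for every `μ ∈ perturbedLimitPoints β 𝓦` and every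
  smooth cylinder function `F = f((U_e)_{e∈Λ})`.
* ★★★ `su2_perturbedLimit_variance_le_integral_Gam_oneEighth` — `SU(2)`, `d = 4`, every `0 ≤ β_W ≤ 1/8`, every family whose members carry load witnesses with
  per-link loads `(a, ℓ_s, column Λ) ≤ (1/100, 1/500, 1/500)`: every limit state satisfies `Var_μ(F) ≤ (65/16) ∫ Γ(f,f) dμ`; and the general-loads form
  `su2_perturbedLimit_variance_le_integral_Gam` (`0 ≤ β_W < 1/3`, `c := (9β_W/2)e^{ε₀}(1 + 2√2 ε₁) + √2 ε₂ < 1`, constant `e^{ε₀}((1 − c)(1 − 3β_W))⁻¹`).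
0 sorry, 0 definitions.  Everything here is proved. [folklore]
-/

noncomputable section

open scoped Matrix ComplexConjugate BigOperators Matrix.Norms.Frobenius ContDiff Topology ProbabilityTheory
open Matrix Complex Finset MeasureTheory Filter ProbabilityTheory Function Real
open Literature.MathematicalPhysics.QuantumFieldTheory
open Literature.MathematicalPhysics.QuantumLattice (fundamentalRep continuous_fundamentalRep LGConfig
  torusEdge torusLift toTorusObservable IsCylinder)
open Literature.MathematicalPhysics.QuantumFieldTheory.SUNBakryEmery (SUN FrameIdx frame)
open Summit.Ventures.YMGap.LatticeBakryEmery

namespace Summit.Ventures.YMGap.RobustBall.LangevinPoincare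

variable {N : ℕ}

/-- ★★★ **From a family-uniform torus Poincaré inequality in GRADIENT form to every perturbed infinite-volume limit**: if for every `L ≥ 1` and every smooth
`g` of the link matrices of the torus of side `L + 1`, `Var_{μ_{β,𝓦 L}}(g) ≤ C ∫ Γ(g,g) dμ_{β,𝓦 L}`, then every `μ ∈ perturbedLimitPoints β 𝓦` satisfies
`Var_μ(F) ≤ C ∫ Γ(f,f)((U_e)_{e∈Λ}) dμ(U)` for every smooth cylinder function `F = f((U_e)_{e∈Λ})`. [folklore] -/
theorem variance_le_integral_Gam_of_mem_perturbedLimitPoints_of_torus {β C : ℝ} {𝓦 : PerturbationFamily 4 N}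
    (htorus : ∀ L : ℕ, 1 ≤ L → ∀ {g : Cfg (Edge 4 (L + 1)) N → ℝ}, ContDiff ℝ ∞ g →
      Var[fun U => g (emb U); (𝓦 L).perturbedMeasure (fundamentalRep (Fin N)) β] ≤
        C * ∫ U, Gam g g (emb U) ∂((𝓦 L).perturbedMeasure (fundamentalRep (Fin N)) β))
    {μ : Measure (LGConfig 4 (Matrix.specialUnitaryGroup (Fin N) ℂ))} (hμ : μ ∈ perturbedLimitPoints β 𝓦)
    (Λ : Finset (ZdEdge 4)) {f : (↥Λ → Matrix (Fin N) (Fin N) ℂ) → ℝ} (hf : ContDiff ℝ ∞ f) :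
    Var[matrixCylinder Λ f; μ] ≤ C * ∫ U, Gam f f (fun e : ↥Λ => (U e : Matrix (Fin N) (Fin N) ℂ)) ∂μ := by
  obtain ⟨Ls, hLs, hprob, hlim⟩ := hμ
  haveI := hprob
  set F : LGConfig 4 (Matrix.specialUnitaryGroup (Fin N) ℂ) → ℝ := matrixCylinder Λ f with hF
  set G : LGConfig 4 (Matrix.specialUnitaryGroup (Fin N) ℂ) → ℝ := fun U => Gam f f (fun e : ↥Λ => (U e : Matrix (Fin N) (Fin N) ℂ)) with hG
  have hcfgc : Continuous fun (U : LGConfig 4 (Matrix.specialUnitaryGroup (Fin N) ℂ)) (e : ↥Λ) => (U e : Matrix (Fin N) (Fin N) ℂ) :=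
    continuous_pi fun e => continuous_subtype_val.comp (continuous_apply _)
  have hFcyl : IsCylinder F Λ := isCylinder_matrixCylinder Λ f
  have hFc : Continuous F := hf.continuous.comp hcfgc
  have hGcyl : IsCylinder G Λ := fun U V hUV => by
    show Gam f f _ = Gam f f _
    congr 1
    funext e
    rw [hUV e e.2]
  have hGc : Continuous G := (contDiff_Gam hf hf).continuous.comp hcfgc
  obtain ⟨C₀, hC0⟩ : ∃ C₀, ∀ U, |F U| ≤ C₀ := by
    obtain ⟨C₀, hb⟩ := (isCompact_univ (X := LGConfig 4 (Matrix.specialUnitaryGroup (Fin N) ℂ))).exists_bound_of_continuousOn hFc.continuousOn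
    exact ⟨C₀, fun U => by simpa [Real.norm_eq_abs] using hb U (Set.mem_univ _)⟩
  obtain ⟨CG, hCG⟩ : ∃ CG, ∀ U, |G U| ≤ CG := by
    obtain ⟨C₀, hb⟩ := (isCompact_univ (X := LGConfig 4 (Matrix.specialUnitaryGroup (Fin N) ℂ))).exists_bound_of_continuousOn hGc.continuousOn
    exact ⟨C₀, fun U => by simpa [Real.norm_eq_abs] using hb U (Set.mem_univ _)⟩
  have hF2cyl : IsCylinder (fun U => F U ^ 2) Λ := fun U V hUV => by
    show F U ^ 2 = F V ^ 2
    rw [hFcyl hUV]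
  have ht1 := hlim F Λ hFcyl hFc ⟨C₀, hC0⟩
  have ht2 := hlim (fun U => F U ^ 2) Λ hF2cyl (hFc.pow 2) ⟨C₀ ^ 2, fun U => by
    rw [abs_pow]; exact pow_le_pow_left₀ (abs_nonneg _) (hC0 U) 2⟩
  have ht3 := hlim G Λ hGcyl hGc ⟨CG, hCG⟩
  have hmem : MemLp F 2 μ := MemLp.of_bound hFc.aestronglyMeasurable C₀ (ae_of_all _ fun U => by rw [Real.norm_eq_abs]; exact hC0 U)
  have hvarμ : Var[F; μ] = (∫ U, F U ^ 2 ∂μ) - (∫ U, F U ∂μ) ^ 2 := by rw [variance_eq_sub hmem]; rfl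
  have htv : Tendsto (fun k => (𝓦 (Ls k)).expectation (fundamentalRep (Fin N)) β (toTorusObservable (Ls k + 1) fun U => F U ^ 2) -
      (𝓦 (Ls k)).expectation (fundamentalRep (Fin N)) β (toTorusObservable (Ls k + 1) F) ^ 2) atTop (𝓝 (Var[F; μ])) := by
    rw [hvarμ]; exact ht2.sub (ht1.pow 2)
  have htG : Tendsto (fun k => C * (𝓦 (Ls k)).expectation (fundamentalRep (Fin N)) β (toTorusObservable (Ls k + 1) G)) atTop
      (𝓝 (C * ∫ U, G U ∂μ)) := ht3.const_mul C
  have h2 : Tendsto (fun k => Ls k + 1) atTop atTop := tendsto_atTop_mono (fun k => Nat.le_succ (Ls k)) hLs.tendsto_atTop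
  have hev : ∀ᶠ k : ℕ in atTop,
      (𝓦 (Ls k)).expectation (fundamentalRep (Fin N)) β (toTorusObservable (Ls k + 1) fun U => F U ^ 2) -
        (𝓦 (Ls k)).expectation (fundamentalRep (Fin N)) β (toTorusObservable (Ls k + 1) F) ^ 2
        ≤ C * (𝓦 (Ls k)).expectation (fundamentalRep (Fin N)) β (toTorusObservable (Ls k + 1) G) := by
    have hinj : ∀ᶠ k : ℕ in atTop, Set.InjOn (torusEdge (d := 4) (Ls k + 1)) ↑Λ :=
      h2.eventually (LatticeBakryEmery.eventually_injOn_torusEdge (d := 4) Λ)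
    have hge : ∀ᶠ k : ℕ in atTop, 1 ≤ Ls k := hLs.tendsto_atTop.eventually (eventually_ge_atTop 1)
    refine (hinj.and hge).mono fun k hk => ?_
    obtain ⟨hk, hk1⟩ := hk
    set L' : ℕ := Ls k + 1 with hL'
    set j : ↥Λ → Edge 4 L' := fun e => torusEdge L' (e : ZdEdge 4) with hj
    have hjinj : Function.Injective j := fun e₁ e₂ h => Subtype.ext (hk e₁.2 e₂.2 h)
    set g : Cfg (Edge 4 L') N → ℝ := fun Q => f fun e : ↥Λ => Q (j e) with hg
    have hgc : ContDiff ℝ ∞ g := hf.comp (contDiff_pi.2 fun e => contDiff_apply ℝ _ (j e))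
    have hT := htorus (Ls k) hk1 hgc
    haveI := isProbabilityMeasure_perturbedMeasure (𝓦 (Ls k)) β
    have hgF : (fun U : PSU (Edge 4 L') N => g (emb U)) = toTorusObservable L' F := by funext U; rfl
    have hgc' : Continuous fun U : PSU (Edge 4 L') N => g (emb U) := continuous_restrict hgc
    have hmemk : MemLp (fun U : PSU (Edge 4 L') N => g (emb U)) 2 ((𝓦 (Ls k)).perturbedMeasure (fundamentalRep (Fin N)) β) :=
      MemLp.of_bound hgc'.aestronglyMeasurable C₀ (ae_of_all _ fun U => by rw [Real.norm_eq_abs]; exact hC0 (torusLift L' U))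
    have hvk : Var[fun U : PSU (Edge 4 L') N => g (emb U); (𝓦 (Ls k)).perturbedMeasure (fundamentalRep (Fin N)) β] =
        (𝓦 (Ls k)).expectation (fundamentalRep (Fin N)) β (toTorusObservable L' fun U => F U ^ 2) -
          (𝓦 (Ls k)).expectation (fundamentalRep (Fin N)) β (toTorusObservable L' F) ^ 2 := by
      rw [variance_eq_sub hmemk, hgF]; rfl
    have hGam : ∀ U : PSU (Edge 4 L') N, Gam g g (emb U) = toTorusObservable L' G U := fun U => by
      have h := Gam_comp_restrict hjinj hf (emb U)
      simp only [hg] at h ⊢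
      rw [h]
      rfl
    have hGk : ∫ U, Gam g g (emb U) ∂((𝓦 (Ls k)).perturbedMeasure (fundamentalRep (Fin N)) β) =
        (𝓦 (Ls k)).expectation (fundamentalRep (Fin N)) β (toTorusObservable L' G) := by
      simp_rw [hGam]; rfl
    rw [← hvk, ← hGk]
    exact hT
  exact le_of_tendsto_of_tendsto htv htG hev

/-- ★★ **`SU(2)`, `d = 4`: the Langevin Poincaré inequality for every infinite-volume limit state of a member family with per-link loads `(a, ℓ_s, column Λ) ≤
(ε₀, ε₁, ε₂)`** (tree coupling `β_W/2`, `0 ≤ β_W < 1/3`, `c := (9β_W/2)e^{ε₀}(1 + 2√2 ε₁) + √2 ε₂ < 1`): for every `μ ∈ perturbedLimitPoints (β_W/2) 𝓦` and every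
smooth cylinder function, `Var_μ(F) ≤ e^{ε₀}((1 − c)(1 − 3β_W))⁻¹ ∫ Γ(f,f) dμ`. [folklore] -/
theorem su2_perturbedLimit_variance_le_integral_Gam {βW ε₀ ε₁ ε₂ c : ℝ} (h0 : 0 ≤ βW) (h13 : βW < 1 / 3) {𝓦 : PerturbationFamily 4 2}
    (hW : ∀ L : ℕ, ∃ w : LoadWitness (𝓦 L), (∀ e, w.oscLoad 0 e ≤ ε₀) ∧ (∀ e, w.selfLipLoad 0 e ≤ ε₁) ∧
      (∀ y, ∑ e ∈ univ.erase y, w.crossLip 0 e y ≤ ε₂))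
    (hc : 9 * βW / 2 * Real.exp ε₀ * (1 + 2 * Real.sqrt 2 * ε₁) + Real.sqrt 2 * ε₂ ≤ c) (hc1 : c < 1)
    {μ : Measure (LGConfig 4 (Matrix.specialUnitaryGroup (Fin 2) ℂ))} (hμ : μ ∈ perturbedLimitPoints (βW / 2) 𝓦)
    (Λ : Finset (ZdEdge 4)) {f : (↥Λ → Matrix (Fin 2) (Fin 2) ℂ) → ℝ} (hf : ContDiff ℝ ∞ f) :
    Var[matrixCylinder Λ f; μ] ≤
      Real.exp ε₀ * ((1 - c) * (1 - 3 * βW))⁻¹ * ∫ U, Gam f f (fun e : ↥Λ => (U e : Matrix (Fin 2) (Fin 2) ℂ)) ∂μ := by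
  refine variance_le_integral_Gam_of_mem_perturbedLimitPoints_of_torus (fun L hL => fun hg => ?_) hμ Λ hf
  obtain ⟨w, ha, hs, hcol⟩ := hW L
  exact su2_variance_le_integral_Gam_onBall (L := L + 1) h0 h13 (by omega) w ha hs hcol hc hc1 hg

/-- ★★★ **THE SPRINT LOADS, EVERY `0 ≤ β_W ≤ 1/8`, EVERY LIMIT STATE**: for `SU(2)`, `d = 4`, every family of members with per-link loads
`(a, ℓ_s, column Λ) ≤ (1/100, 1/500, 1/500)`, every `μ ∈ perturbedLimitPoints (β_W/2) 𝓦` and every smooth cylinder function `F = f((U_e)_{e∈Λ})`: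
`Var_μ(F) ≤ (65/16) ∫ Γ(f,f) dμ` — the Langevin Poincaré inequality of the infinite-volume perturbed states, uniformly on this ball. [folklore] -/
theorem su2_perturbedLimit_variance_le_integral_Gam_oneEighth {βW : ℝ} (h0 : 0 ≤ βW) (h8 : βW ≤ 1 / 8) {𝓦 : PerturbationFamily 4 2}
    (hW : ∀ L : ℕ, ∃ w : LoadWitness (𝓦 L), (∀ e, w.oscLoad 0 e ≤ 1 / 100) ∧ (∀ e, w.selfLipLoad 0 e ≤ 1 / 500) ∧
      (∀ y, ∑ e ∈ univ.erase y, w.crossLip 0 e y ≤ 1 / 500))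
    {μ : Measure (LGConfig 4 (Matrix.specialUnitaryGroup (Fin 2) ℂ))} (hμ : μ ∈ perturbedLimitPoints (βW / 2) 𝓦)
    (Λ : Finset (ZdEdge 4)) {f : (↥Λ → Matrix (Fin 2) (Fin 2) ℂ) → ℝ} (hf : ContDiff ℝ ∞ f) :
    Var[matrixCylinder Λ f; μ] ≤ (65 / 16 : ℝ) * ∫ U, Gam f f (fun e : ↥Λ => (U e : Matrix (Fin 2) (Fin 2) ℂ)) ∂μ := by
  refine variance_le_integral_Gam_of_mem_perturbedLimitPoints_of_torus (fun L hL => fun hg => ?_) hμ Λ hf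
  obtain ⟨w, ha, hs, hcol⟩ := hW L
  exact su2_variance_le_integral_Gam_onBall_oneEighth (L := L + 1) h0 h8 (by omega) w ha hs hcol hg

end Summit.Ventures.YMGap.RobustBall.LangevinPoincare

end
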